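import Summits.ResolutionOfSingularities.ResolutionOfSingularities.Theorems.EquisingularLiftEquisingularLiftNatTowerCechRootCentre
import Summits.ResolutionOfSingularities.ResolutionOfSingularities.Theorems.EquisingularLiftEquisingularLiftNatDirectionSections
import Summits.ResolutionOfSingularities.ResolutionOfSingularities.Theorems.EquisingularLiftEquisingularLiftNatDirectionLiftGlue
import Summits.ResolutionOfSingularities.ResolutionOfSingularities.Theorems.EquisingularLiftEquisingularLiftNatProportionalCocycle
import Summits.ResolutionOfSingularities.ResolutionOfSingularities.Theorems.EquisingularLiftEquisingularLiftNatP1VBPackage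
import Summits.ResolutionOfSingularities.ResolutionOfSingularities.Theorems.EquisingularLiftEquisingularLiftNatDirectionOfChartFamily
import Summits.ResolutionOfSingularities.ResolutionOfSingularities.Theorems.EquisingularLiftEquisingularLiftNatCentreRegularImmersion
import Summits.ResolutionOfSingularities.ResolutionOfSingularities.Theorems.EquisingularLiftEquisingularLiftNatCentreCodimOfFrames
import Summits.ResolutionOfSingularities.ResolutionOfSingularities.Theorems.EquisingularLiftEquisingularLiftNatRationalCarrierLift
import Summits.ResolutionOfSingularities.ResolutionOfSingularities.Theorems.EquisingularLiftEquisingularLiftNatDirLiftChartColumn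
import Summits.ResolutionOfSingularities.ResolutionOfSingularities.Theorems.EquisingularLiftEquisingularLiftNatDirLiftChartCompat
import Summits.ResolutionOfSingularities.ResolutionOfSingularities.Theorems.EquisingularLiftEquisingularLiftNatDirLiftChartReduction
import Summits.ResolutionOfSingularities.ResolutionOfSingularities.Theorems.EquisingularLiftEquisingularLiftNatDirLiftGlue
import Summits.ResolutionOfSingularities.ResolutionOfSingularities.Theorems.EquisingularLiftEquisingularLiftNatCechTransferPlumbing
import Summits.ResolutionOfSingularities.ResolutionOfSingularities.Theorems.EquisingularLiftEquisingularLiftNatCokernelLocallySplit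
import Literature.AlgebraicGeometry.Modules.LineBundleOfCocycleClass
import Summits.ResolutionOfSingularities.ResolutionOfSingularities.Theorems.EquisingularLiftEquisingularLiftNatDirLiftQuotientClass
import Summits.ResolutionOfSingularities.ResolutionOfSingularities.Theorems.EquisingularLiftEquisingularLiftNatDirLiftRankAdditive
import Summits.ResolutionOfSingularities.ResolutionOfSingularities.Theorems.EquisingularLiftEquisingularLiftNatExceptionalReduced
import Literature.AlgebraicGeometry.Resolution.BlowupDisjointCentreSplitting
import Summits.ResolutionOfSingularities.ResolutionOfSingularities.Theorems.EquisingularLiftEquisingularLiftNatConormalSectionClass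
import Summits.ResolutionOfSingularities.ResolutionOfSingularities.Theorems.EquisingularLiftEquisingularLiftNatDirLiftUnobsAssembly
import Literature.AlgebraicGeometry.Motives.ProjBaseChangeAny
import HarnessLib

/-!
# [OURS · L1 W4.5(b) · EL♮(3)] THE (L) SOCKET `stub_elnat_three_liftSections` — the direction lift at the root of a Čech round
# (T-DIRLIFT-UP, route C), assembled from the chain's bricks

Crux chain w45b (cell `res-hironaka`, slot W4.5(b)), working crux **EL♮** = stmt-ResolutionOfSingularities-20038, child **EL♮(3)** =
stmt-ResolutionOfSingularities-20148, route EquisingularLift, line `sections`. `Tower.hLift_of_bricks` has EXACTLY the type of the registered stub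
`stub_elnat_three_liftSections` of CHILD skeleton v23 (res-L1-w45b-lead-2, SEVENTEENTH registration) = the `hL` socket of the n = 3 plugs
p579941 / p584312 (res-D-pv-018 / res-L1-w45b-stub-2) = the `hLift` binder of `Tower.hCech₃_of_lift_sec_kiv` (p579344) closed over the global context.
With it the rungs ratDirZero / coneTower / ratNoseTower at n = 3 are hypothesis-free (F-102 p583830 ✓, (N3) p581085 ✓, (N3′) p583769 ✓).
HONEST FRAMING: OURS; NOT a statement of any manuscript; AI-written, weaker than expert review. No `sorry`; standard axioms; DEF-FREE.
`--supports stmt-ResolutionOfSingularities-20148 --as helper` (hand of record res-L1-w45b-stub-4 g9; desk word 2026-08-27T23:09:59Z).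

PROOF (route C of res-D-pv-051's T-DIRLIFT-UP, `L/res-D-pv-051/TARGET-DIRLIFT.sig.md`): `e : V(I) ≅ ℙ¹_O` from the `RationalCarrier` clause;
G2 `isLocallyNoetherian_of_modelSquare`; `hri` (res-D-brk-4 `isRegularImmersionOfCodim_two_of_twoFrames` ∘ res-L1-w45b-stub-3
`forall_codim_two_of_twoFrames`); G1 `exists_iso_comap_of_modelSquare` (`ψ : ℙ¹_k ≅ V(I·𝒪_{G₀})`); C1c `P1VB.exists_directionSections`
(res-D-pv-051 p571652); C1b `exists_subLineBundle_of_proportional` ⇒ `ι₀ : L₀ ↪ g^*e.inv^*𝒞`; G3/G5 (frames, `Mono ι₀`), `Q := cokernel ι₀`;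
**C2** = `hQ : Ȟ¹(𝓗om(L₀, Q)) = 0` on the two standard charts of `ℙ¹_k`, from `hunobs : DirStepUnobs G E hE Z hZ` by res-L1-w45b-lead-2's
`subsingleton_cechMH1_sheafHom_Dplus_of_dirStepUnobs` (B0 res-L1-w45b-stub-2 · K1/B1a/B1c/Σ1/(★) res-type-027 · B2/B2′ res-D-pv-036 · B1′/X1
res-L1-w45b-stub-3 · B1b res-rescue-typ-5 · B3-transfer/plumbing/(S3)/X4/Σ2 res-L1-w45b-stub-2 · X2-uniq/transport res-D-pv-035 · X2/Σ3/glue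
res-L1-w45b-stub-4) over res-type-027's Euler bridge (★) `cechPic_pullback_detClass_conormal_section`; T-P1VB
`exists_subLineBundle_lift_projectiveLine` (res-type-027) ⇒ the lift `σ`; **C3⁺** = the upstairs direction from the lifted columns: per-point
packages (C3-ii) `exists_dirLift_chartColumn` (res-rescue-typ-5 p585658), a finite subcover of `ℙ¹_O`, overlap compatibility (C3-iii)
`dirLift_chartColumn_compat` (res-L1-w45b-lead-2 p585830), gluing (C3-i) `exists_direction_of_chartColumns_family` (res-L1-w45b-stub-3 p583824 over
res-L1-w45b-stub-2's p566849), reduction (C3-iv) `dirLift_chartColumn_reduction` (res-L1-w45b-stub-4 p588671) + `comap_eq_of_chartSections_family`.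

References (method / index only): R. Hartshorne, *Algebraic Geometry* (1977), II.5, II §8, III Ex. 4.5, V §2; A. Grothendieck, EGA III §4–5.
-/

set_option linter.dupNamespace false
set_option linter.overlappingInstances false

noncomputable section

open CategoryTheory CategoryTheory.Limits AlgebraicGeometry TopologicalSpace Topology IsLocalRing Opposite
open Literature.AlgebraicGeometry.Resolution
open Literature.AlgebraicGeometry.Morphisms (ProjCech.PP ProjCech.toSpec)
open Literature.AlgebraicGeometry.Modules Literature.AlgebraicGeometry.Motives
open Literature.AlgebraicGeometry.Deformation Literature.AlgebraicGeometry.HodgeTheory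
open AlgebraicGeometry.Scheme.IdealSheafData
open Literature.AlgebraicGeometry.Morphisms (CechMH1 ProjCech.Dplus)
open Summit.ResolutionOfSingularities.ResolutionOfSingularities.Theses.EquisingularLift.Split
open Summit.ResolutionOfSingularities.ResolutionOfSingularities.Cruxes.EquisingularLift.StrataSplit

namespace Summit.ResolutionOfSingularities.ResolutionOfSingularities.Cruxes.EquisingularLiftNat.Sections

open Summit.ResolutionOfSingularities.ResolutionOfSingularities.Cruxes.EquisingularLiftNat.P1VB


/-- `ℙ¹_O` is quasi-compact. [folklore] -/
theorem compactSpace_PP_one (O : Type) [CommRing O] : CompactSpace (ProjCech.PP O 1) :=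
  haveI : IsProper (ProjCech.toSpec O 1) := ProjBaseChangeRing.isProper_projToSpec (Fin 2) O
  haveI : UniversallyClosed (ProjCech.toSpec O 1) := IsProper.toUniversallyClosed
  haveI : QuasiCompact (ProjCech.toSpec O 1) := AlgebraicGeometry.instQuasiCompactOfUniversallyClosed _
  QuasiCompact.compactSpace_of_compactSpace (ProjCech.toSpec O 1)

/-- **A rank-one frame of the cocycle line bundle whose basis section `ι` sends to a UNIT multiple of `w_p`.** For
`ι : lineBundle c ⟶ G` with `ι|_{U_z} = (s ↦ s_z · w_z)`: the frame `𝒪 ≅ (lineBundle c)|_{U_p}` of the local trivialisation has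
`ι(b) = u · w_p` with `u` (the trivialised basis section) a unit. [folklore] -/
theorem exists_frame_unit_of_lineBundleTriv {Y : Scheme.{0}} (c : UnitCocycle Y) {G : Y.Modules} (w : ∀ z, Γ(G, c.U z))
    (ι : lineBundle c ⟶ G) (hι : ∀ z, (SheafOfModules.overFunctor _ (c.U z)).map ι = c.lineBundleTrivInv z ≫ smulSection (w z))
    (p : Y) :
    ∃ (φp : SheafOfModules.free (Fin 1) ≅ (lineBundle c).over (c.U p)) (u : Γ(Y, c.U p)),
      IsUnit u ∧ ι.app (c.U p) (basisSection φp 0) = u • w p := by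
  let φp : SheafOfModules.free (Fin 1) ≅ (lineBundle c).over (c.U p) :=
    eqToIso (SheafOfModules.freeFunctor_obj (R := Y.ringCatSheaf.over (c.U p)) (Fin 1)).symm ≪≫
      (SheafOfModules.freeFunctor (R := Y.ringCatSheaf.over (c.U p))).mapIso (Equiv.ofUnique (Fin 1) PUnit).toIso ≪≫
      eqToIso (SheafOfModules.freeFunctor_obj (R := Y.ringCatSheaf.over (c.U p)) PUnit) ≪≫ c.lineBundleFrame p
  refine ⟨φp, appLE (c.lineBundleTriv p).inv (𝟙 _) (basisSection φp 0), ?_, ?_⟩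
  · -- the trivialised basis section of a rank-one frame is a unit
    let one : Γ(unitModule Y, c.U p) := (1 : Γ(Y, c.U p))
    have h1 : @Eq Γ(Y, c.U p) (appLE (c.lineBundleTriv p).inv (𝟙 _) (appLE (c.lineBundleTriv p).hom (𝟙 _) one)) 1 := by
      rw [← appLE_comp, Iso.hom_inv_id, appLE_id]
    have h2 := eq_sum_coord_smul φp (𝟙 _) (appLE (c.lineBundleTriv p).hom (𝟙 _) one)
    rw [Fin.sum_univ_one, presheaf_map_id] at h2
    rw [h2, appLE_smul_right] at h1
    exact IsUnit.of_mul_eq_one_right _ h1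
  · change appLE ((SheafOfModules.overFunctor _ (c.U p)).map ι) (𝟙 _) (basisSection φp 0) = _
    rw [hι p, appLE_comp, appLE_smulSection, presheaf_map_id]
    rfl


/-- **(L) — the direction lift at the root (`stub_elnat_three_liftSections`, text VERBATIM).** See the module docstring.
[cite: Hartshorne1977, II.5 and V §2 (ruled surfaces; method only)] [OURS · L1 W4.5b · T-DIRLIFT-UP (L) assembled] toward
`stub_elnat_coneTowerPointResolution` / `stub_elnat_ratNoseTowerResolution` / `stub_elnat_ratDirZeroPointResolution` (stmt-ResolutionOfSingularities-20148);
NOT a statement of the manuscript. -/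
theorem stub_elnat_three_liftSections :
    ∀ (k : Type) [Field k] [IsAlgClosed k]
      (O : Type) [CommRing O] [IsDomain O] [IsDiscreteValuationRing O] [IsAdicComplete (IsLocalRing.maximalIdeal O) O]
      [IsAlgClosed (IsLocalRing.ResidueField O)] (θ : O →+* k) (hθ : Function.Surjective θ)
      (P : Scheme.{0}) (q : P ⟶ Spec (.of O)) (Y : Set P) (Ch : ∀ X' : Scheme.{0}, (X' ⟶ P) → Set X' → Prop)
      (hChStep : ∀ (X' X'' : Scheme.{0}) (σ' : X' ⟶ P) (S' : Set X') (C : X'.IdealSheafData) (τ : X'' ⟶ X'),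
        Ch X' σ' S' → IsBlowup τ C → Scheme.IsRegular C.subscheme → Flat (C.subschemeι ≫ σ' ≫ q) →
        σ' '' (C.support : Set X') ⊆ {y | ¬ IsGenericPoint y Y} → (C.support : Set X') ∩ (σ' ≫ q) ⁻¹' {IsLocalRing.closedPoint O} ⊆ S' →
        Ch X'' (τ ≫ σ') (closure (τ ⁻¹' (S' \ (C.support : Set X')))))
      (hChSplit : ∀ (X' : Scheme.{0}) (σ' : X' ⟶ P) (S' : Set X'), Ch X' σ' S' → Chain P Y X' σ' S')
      (hYsp : Y ⊆ q ⁻¹' {IsLocalRing.closedPoint O}) (hYirr : IsIrreducible Y) (hYcl : IsClosed Y) (hPint : IsIntegral P)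
      (hPnoeth : IsLocallyNoetherian P) (hPreg : Scheme.IsRegular P) (hqprop : IsProper q) (hqsm : SmoothOfRelativeDimension 3 q),
      RationalCarrierLift O k θ P q →
      ∀ {F₉ : Scheme.{0}} (Z₉ : Set F₉) (hZ₉ : IsClosed Z₉)
          (G : Scheme.{0}) (E : Set G) (hE : IsClosed E) (Z : Set G) (hZ : IsClosed Z)
          (X₀ : Scheme.{0}) (σ₀ : X₀ ⟶ P) (I : X₀.IdealSheafData) (G₀ : Scheme.{0}) (j₀ : G₀ ⟶ X₀) (t₀ : G₀ ⟶ Spec (.of k))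
          (Z₀ : Set G₀) (hZ₀ : IsClosed Z₀) (G₁ : Scheme.{0}) (υ₁ : G₁ ⟶ G₀) (ϱ : G ⟶ G₁)
          (E₁ : Set G₁) (hE₁ : IsClosed E₁) (Γ₁ : Set G₁) (hΓ₁ : IsClosed Γ₁)
          (ε : redSub G E hE ⟶ redSub G₁ E₁ hE₁) (εZ : redSub G Z hZ ⟶ redSub G₁ Γ₁ hΓ₁) (𝒟' : G₀.IdealSheafData),
          -- the root (R1)–(R4)
          IsIntegral X₀ → IsLocallyNoetherian X₀ → Scheme.IsRegular X₀ →
          IsPullback j₀ t₀ (σ₀ ≫ q) (Spec.map (CommRingCat.ofHom θ)) →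
          Scheme.IsRegular I.subscheme → Flat (I.subschemeι ≫ σ₀ ≫ q) →
          (∀ x ∈ I.support, ∃ c : Fin 2 → X₀.presheaf.stalk x, Ideal.span (Set.range c) = stalkIdeal I x ∧ IsQuasiRegular c) →
          RationalCarrier (redSub F₉ Z₉ hZ₉) →
          (RationalCarrier (redSub F₉ Z₉ hZ₉) → ∃ e₁ : I.subscheme ≅ ProjCech.PP O 1, e₁.hom ≫ ProjCech.toSpec O 1 = I.subschemeι ≫ σ₀ ≫ q) →
          I.comap j₀ = vanishingIdeal ⟨Z₀, hZ₀⟩ →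
          -- the downstairs round at the root: blow-up of the carrier trace, the pushed section `Γ₁ ⊆ E₁ = υ₁⁻¹Z₀`
          IsBlowup υ₁ (vanishingIdeal (⟨Z₀, hZ₀⟩ : Closeds G₀)) → E₁ = υ₁ ⁻¹' Z₀ → Γ₁ ⊆ E₁ → Γ₁ = ϱ '' Z → Z ⊆ E →
          (∃ δ₁ : redSub G₁ Γ₁ hΓ₁ ⟶ redSub G₀ Z₀ hZ₀, δ₁ ≫ redSubι G₀ Z₀ hZ₀ = redSubι G₁ Γ₁ hΓ₁ ≫ υ₁ ∧ IsIso δ₁) →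
          (∀ (i₁ : redSub G₁ Γ₁ hΓ₁ ⟶ redSub G₁ E₁ hE₁), i₁ ≫ redSubι G₁ E₁ hE₁ = redSubι G₁ Γ₁ hΓ₁ →
            ∀ x₁ : redSub G₁ Γ₁ hΓ₁, IsRegularLocalRing ((redSub G₁ E₁ hE₁).presheaf.stalk (i₁ x₁))) →
          -- the stage's unobstructedness datum, handed with the special-fibre isomorphisms (exceptional pair abstracted)
          IsIso ε → ε ≫ redSubι G₁ E₁ hE₁ = redSubι G E hE ≫ ϱ → IsIso εZ → εZ ≫ redSubι G₁ Γ₁ hΓ₁ = redSubι G Z hZ ≫ ϱ →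
          (∀ x : redSub G Z hZ, IsRegularLocalRing (G.presheaf.stalk (redSubι G Z hZ x))) → DirStepUnobs G E hE Z hZ →
          -- the downstairs direction of `Γ₁` (DIRDICT (a) `exists_direction_of_section`, output block verbatim)
          vanishingIdeal (⟨Z₀, hZ₀⟩ : Closeds G₀) * vanishingIdeal (⟨Z₀, hZ₀⟩ : Closeds G₀) ≤ 𝒟' → 𝒟' ≤ vanishingIdeal (⟨Z₀, hZ₀⟩ : Closeds G₀) →
          (∀ z ∈ Z₀, ∃ c : Fin 2 → G₀.presheaf.stalk z,
            Ideal.span (Set.range c) = stalkIdeal (vanishingIdeal (⟨Z₀, hZ₀⟩ : Closeds G₀)) z ∧ IsQuasiRegular c ∧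
            stalkIdeal 𝒟' z = Ideal.span {c 0} ⊔ Ideal.span {c 1 * c 1}) →
          controlledTransform υ₁ (vanishingIdeal (⟨Z₀, hZ₀⟩ : Closeds G₀)) 𝒟' 1 = vanishingIdeal (⟨Γ₁, hΓ₁⟩ : Closeds G₁) →
          ∃ 𝒟 : X₀.IdealSheafData, I * I ≤ 𝒟 ∧ 𝒟 ≤ I ∧
            (∀ x ∈ I.support, ∃ c : Fin 2 → X₀.presheaf.stalk x, Ideal.span (Set.range c) = stalkIdeal I x ∧ IsQuasiRegular c ∧
              stalkIdeal 𝒟 x = Ideal.span {c 0} ⊔ Ideal.span {c 1 * c 1}) ∧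
            𝒟.comap j₀ = 𝒟'
    := by
  intro k _ _ O _ _ _ _ _ θ hθ P q Y Ch hChStep hChSplit hYsp hYirr hYcl hPint hPnoeth hPreg hqprop hqsm hRCL F₉ Z₉ hZ₉ G E hE Z hZ
    X₀ σ₀ I G₀ j₀ t₀ Z₀ hZ₀ G₁ υ₁ ϱ E₁ hE₁ Γ₁ hΓ₁ ε εZ 𝒟' hXint hXnoeth hXreg hsq hCreg hCflat hfr hrat hRC hĪ hυ₁ hE₁eq hΓE hΓϱ hZE
    hsec hEreg hεiso hεcomm hεZiso hεZcomm hZreg hunobs hII' h𝒟'I hdir' hctr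
  -- instances at the root
  haveI := hXint; haveI := hXnoeth
  letI : Algebra O k := θ.toAlgebra
  letI : GradedAlgebra (MvPolynomial.homogeneousSubmodule (Fin 2) O) := MvPolynomial.gradedAlgebra
  letI : GradedAlgebra (MvPolynomial.homogeneousSubmodule (Fin 2) k) := MvPolynomial.gradedAlgebra
  have halg : algebraMap O k = θ := rfl
  -- (R4) the rational carrier `e : V(I) ≅ ℙ¹_O` over `Spec O`
  obtain ⟨e, he⟩ := hRC hrat
  -- G2: the special fibre is locally Noetherian
  haveI : IsLocallyNoetherian G₀ := isLocallyNoetherian_of_modelSquare θ hθ (σ₀ ≫ q) j₀ t₀ hsq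
  -- `hri`: `V(I) ↪ X₀` is a regular immersion of codimension 2 (frames ⇒ codim ⇒ hri)
  have hri : IsRegularImmersionOfCodim I.subschemeι 2 :=
    isRegularImmersionOfCodim_two_of_twoFrames I hXreg hCreg (forall_codim_two_of_twoFrames hXreg I hCreg hfr)
  -- G1: `ψ : ℙ¹_k ≅ V(I·𝒪_{G₀})` over the model square
  obtain ⟨ψ, hψiso, hψ⟩ := exists_iso_comap_of_modelSquare θ (σ₀ ≫ q) j₀ t₀ hsq (ProjCech.toSpec O 1) (ProjCech.toSpec k 1)
    (Proj.map (ProjBaseChangeRing.mapGraded O k (Fin 2)) (ProjBaseChangeRing.irrelevant_le_map O k (Fin 2)))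
    (ProjBaseChangeRing.isPullback_projMap' O k) I e he
  -- C1c: direction sections of `g^* ε^* 𝒞` on `ℙ¹_k`
  have hdir'' : ∀ z ∈ (I.comap j₀).support, ∃ c : Fin 2 → G₀.presheaf.stalk z,
      Ideal.span (Set.range c) = stalkIdeal (I.comap j₀) z ∧ IsQuasiRegular c ∧
      stalkIdeal 𝒟' z = Ideal.span {c 0} ⊔ Ideal.span {c 1 * c 1} := by
    rw [hĪ]
    exact fun z hz => hdir' z ((mem_support_vanishingIdeal_iff Z₀ hZ₀ z).mp hz)
  obtain ⟨U, hU, w, ρ, hρ, hprop, hDICT⟩ := exists_directionSections j₀ I hri e.inv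
    (Proj.map (ProjBaseChangeRing.mapGraded O k (Fin 2)) (ProjBaseChangeRing.irrelevant_le_map O k (Fin 2)))
    (I.comap j₀) rfl ψ hψ 𝒟' hdir''
  -- C1b: the cocycle line bundle `L₀` and its locally split embedding `ι₀ : L₀ ↪ g^* ε^* 𝒞`
  obtain ⟨ι₀, hι₀, hsplit⟩ := exists_subLineBundle_of_proportional U hU w ρ hρ hprop
  -- G3 / G5: frames of `L₀`, `ι₀` mono, the quotient `Q`
  have hL₀ := fun x => exists_frame_lineBundle (proportionalCocycle U hU w ρ hρ hprop) x
  haveI : Mono ι₀ := mono_of_eval_one (proportionalCocycle U hU w ρ hρ hprop) w ι₀ hι₀ (fun z => ⟨ρ z, hρ z⟩)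
  have hS : (ShortComplex.mk ι₀ (cokernel.π ι₀) (cokernel.condition ι₀)).ShortExact :=
    ShortComplex.ShortExact.mk' (ShortComplex.exact_cokernel ι₀) inferInstance inferInstance
  -- the conormal bundle of `ℙ¹_O ≅ V(I)` is a vector bundle
  have hF : IsVectorBundle ((Scheme.Modules.pullback e.inv).obj (conormalSheaf I.subschemeι)) :=
    ((hri.isFiniteLocallyFree_conormalSheaf).pullback e.inv).isVectorBundle
  -- glue for the C2 assembly: `Φ : ℙ¹_k ≅ Γ̃₁` over `ψ`, the inclusion `i₁ : Γ̃₁ ↪ Ẽ₁`, ranks and finite local freeness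
  obtain ⟨δ₁, hδ₁, hδiso⟩ := hsec
  haveI := hδiso
  haveI := hψiso
  obtain ⟨Φ, hΦ1, hΦ2⟩ := exists_iso_redSub_of_subscheme_eq (I.comap j₀) Z₀ hZ₀ hĪ ψ υ₁ Γ₁ hΓ₁ δ₁ hδ₁
  obtain ⟨i₁, hi₁⟩ := exists_redSub_inclusion E₁ hE₁ Γ₁ hΓ₁ hΓE
  have hL₀1 : HasRank (lineBundle (proportionalCocycle U hU w ρ hρ hprop)) 1 := UnitCocycle.hasRank_lineBundle _
  have hL₀f : IsFiniteLocallyFree (lineBundle (proportionalCocycle U hU w ρ hρ hprop)) := isFiniteLocallyFree_of_hasRank hL₀1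
  have hFf : IsFiniteLocallyFree ((Scheme.Modules.pullback
      (Proj.map (ProjBaseChangeRing.mapGraded O k (Fin 2)) (ProjBaseChangeRing.irrelevant_le_map O k (Fin 2)))).obj
      ((Scheme.Modules.pullback e.inv).obj (conormalSheaf I.subschemeι))) :=
    ((hri.isFiniteLocallyFree_conormalSheaf).pullback e.inv).pullback _
  have hF2 := hasRank_pullback_pullback_conormalSheaf_two I hri e.inv
    (Proj.map (ProjBaseChangeRing.mapGraded O k (Fin 2)) (ProjBaseChangeRing.irrelevant_le_map O k (Fin 2)))
  have hQf : IsFiniteLocallyFree (cokernel ι₀) :=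
    isFiniteLocallyFree_cokernel_of_locallySplit ι₀ hL₀f hFf hsplit
  -- the round data in `Ī := I.comap j₀` currency (inputs of res-type-027's (★))
  have hυ₁' : IsBlowup υ₁ (I.comap j₀) := by rw [hĪ]; exact hυ₁
  have hctr' : controlledTransform υ₁ (I.comap j₀) 𝒟' 1 = vanishingIdeal (⟨Γ₁, hΓ₁⟩ : Closeds G₁) := by rw [hĪ]; exact hctr
  have hEĪ : vanishingIdeal (⟨E₁, hE₁⟩ : Closeds G₁) = (I.comap j₀).comap υ₁ := by
    have hq : ∀ z ∈ Z₀, ∃ (r : ℕ) (c : Fin r → G₀.presheaf.stalk z),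
        Ideal.span (Set.range c) = stalkIdeal (vanishingIdeal (⟨Z₀, hZ₀⟩ : Closeds G₀)) z ∧ IsQuasiRegular c := fun z hz => by
      obtain ⟨c, h1, h2, -⟩ := hdir' z hz
      exact ⟨2, c, h1, h2⟩
    have h := comap_vanishingIdeal_eq_vanishingIdeal_preimage' υ₁ Z₀ hZ₀ hυ₁ hq
    rw [hĪ, h]
    congr 1
    exact Closeds.ext hE₁eq
  -- (★) res-type-027's bridge
  haveI : IsLocallyNoetherian G₁ := hυ₁.isLocallyNoetherian
  obtain ⟨h𝒞1, hstar'⟩ := cechPic_pullback_detClass_conormal_section j₀ I hri e.inv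
    (Proj.map (ProjBaseChangeRing.mapGraded O k (Fin 2)) (ProjBaseChangeRing.irrelevant_le_map O k (Fin 2)))
    (I.comap j₀) rfl ψ hψ 𝒟' hdir'' U hU w ρ hρ hprop hDICT υ₁ hυ₁' E₁ hE₁ Γ₁ hΓ₁ hEĪ hctr' i₁ hi₁ Φ hΦ1
  have h𝒞f : IsFiniteLocallyFree (conormalSheaf i₁) := isFiniteLocallyFree_of_hasRank h𝒞1
  have hstar : CechPic.pullback Φ.hom (detClass h𝒞f) * detClass hFf = detClass hL₀f ^ 2 := hstar' h𝒞f hFf hL₀f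
  -- C2: the unobstructedness in T-P1VB's Čech currency (res-L1-w45b-lead-2's assembly)
  have hQ : Subsingleton (Literature.AlgebraicGeometry.Morphisms.CechMH1 (ProjCech.toSpec k 1)
      (sheafHom (lineBundle (proportionalCocycle U hU w ρ hρ hprop)) (cokernel ι₀))
      (fun i : Fin 2 => Literature.AlgebraicGeometry.Morphisms.ProjCech.Dplus k 1 {i})) :=
    subsingleton_cechMH1_sheafHom_Dplus_of_dirStepUnobs (A := k) G E hE Z hZ G₁ ϱ E₁ hE₁ Γ₁ hΓ₁ ε εZ hZE hΓE hεiso hεcomm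
      hεZiso hεZcomm hunobs i₁ hi₁ h𝒞f h𝒞1 Φ (S := ShortComplex.mk ι₀ (cokernel.π ι₀) (cokernel.condition ι₀)) hS hL₀f hL₀1 hFf hF2 hQf hstar
  -- T-P1VB: the lift `σ : 𝒪(d) ↪ ε^* 𝒞` on `ℙ¹_O` with `g^* σ = e'⁻¹ ≫ ι₀`, locally split
  obtain ⟨a, b, σ, e', hσ, hσsplit⟩ := exists_subLineBundle_lift_projectiveLine (A := O) (k := k) hθ
    ((Scheme.Modules.pullback e.inv).obj (conormalSheaf I.subschemeι)) hF
    (lineBundle (proportionalCocycle U hU w ρ hρ hprop)) (cokernel ι₀) ι₀ (cokernel.π ι₀) (cokernel.condition ι₀) hS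
    hL₀ hsplit hQ
  -- C3⁺: per-point lifted columns on conormal charts of `X₀`
  choose V hV xx ss hgenV hss eV heV AA rr hunim WW κκ hVW hlink using
    fun y => exists_dirLift_chartColumn I hri e (monomialCocycle O a b).glued (exists_frame_monomialGlued O a b) σ hσsplit y
  -- finitely many charts cover `V(I)` (`ℙ¹_O` is quasi-compact)
  have hcpt : IsCompact (Set.univ : Set (ProjCech.PP O 1)) := @isCompact_univ _ _ (compactSpace_PP_one O)
  obtain ⟨t, ht⟩ := hcpt.elim_finite_subcover
    (fun y => ((e.inv ⁻¹ᵁ (I.subschemeι ⁻¹ᵁ (V y : X₀.Opens)) : (ProjCech.PP O 1).Opens) : Set (ProjCech.PP O 1)))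
    (fun y => (e.inv ⁻¹ᵁ (I.subschemeι ⁻¹ᵁ (V y : X₀.Opens))).2)
    (fun y _ => Set.mem_iUnion.mpr ⟨y, hV y⟩)
  have hcov : (I.support : Set X₀) ⊆ ⋃ a : t, ((V a.1 : X₀.Opens) : Set X₀) := by
    intro x hx
    rw [← Scheme.IdealSheafData.range_subschemeι] at hx
    obtain ⟨c, rfl⟩ := hx
    obtain ⟨y, hy, hyc⟩ := Set.mem_iUnion₂.mp (ht (Set.mem_univ (e.hom.base c)))
    refine Set.mem_iUnion.mpr ⟨⟨y, hy⟩, ?_⟩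
    have h : e.inv.base (e.hom.base c) = c := by
      rw [← Scheme.Hom.comp_apply, e.hom_inv_id]; rfl
    change e.hom.base c ∈ e.inv ⁻¹ᵁ (I.subschemeι ⁻¹ᵁ (V y : X₀.Opens)) at hyc
    change I.subschemeι.base (e.inv.base (e.hom.base c)) ∈ (V y : X₀.Opens) at hyc
    rwa [h] at hyc
  -- quasi-regularity of the chart germs at the points of the curve
  have hfr' : ∀ (a : t) (p : X₀) (hp : p ∈ (V a.1 : X₀.Opens)), p ∈ I.support →
      IsQuasiRegular ![(X₀.presheaf.germ (V a.1) p hp).hom (xx a.1 0), (X₀.presheaf.germ (V a.1) p hp).hom (xx a.1 1)] := by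
    intro a p hp hps
    obtain ⟨c', hc', hqr⟩ := hfr p hps
    refine isQuasiRegular_of_span_eq hqr (hc'.symm ▸ (mem_support_iff_stalkIdeal_le I p).mp hps) ?_
    rw [hc', stalkIdeal_eq_map_germ I (V a.1) hp, ← hgenV a.1, Ideal.map_span, ← Set.range_comp]
    congr 1
    ext u; simp only [Set.mem_range, Function.comp_apply]
    constructor
    · rintro ⟨i, rfl⟩; rcases Fin.exists_fin_two.mp ⟨i, rfl⟩ with rfl | rfl
      · exact ⟨0, rfl⟩
      · exact ⟨1, rfl⟩
    · rintro ⟨i, rfl⟩; rcases Fin.exists_fin_two.mp ⟨i, rfl⟩ with rfl | rfl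
      · exact ⟨0, rfl⟩
      · exact ⟨1, rfl⟩
  have hsum : ∀ (y : ProjCech.PP O 1), ∑ j, AA y j * xx y j = AA y 0 * xx y 0 + AA y 1 * xx y 1 := fun y => Fin.sum_univ_two _
  obtain ⟨𝒟, hII, h𝒟I, h𝒟st, hfrm⟩ := exists_direction_of_chartColumns_family I (fun a : t => V a.1) hcov
    (fun a => xx a.1 0) (fun a => xx a.1 1) (fun a => AA a.1 0) (fun a => AA a.1 1) (fun a => rr a.1 0) (fun a => rr a.1 1)
    (fun a => by rw [← hgenV a.1, span_range_fin_two]) hfr'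
    (fun a => by have h := hunim a.1; rwa [Fin.sum_univ_two] at h)
    (fun a b p ha hb => by
      have h := dirLift_chartColumn_compat I hfr e _ σ (V a.1) (xx a.1) (ss a.1) (hgenV a.1) (hss a.1) (eV a.1) (heV a.1)
        (AA a.1) (WW a.1) (κκ a.1) (hVW a.1) (hlink a.1) (V b.1) (xx b.1) (ss b.1) (hgenV b.1) (hss b.1) (eV b.1) (heV b.1)
        (AA b.1) (WW b.1) (κκ b.1) (hVW b.1) (hlink b.1) p ha hb
      rwa [hsum, hsum] at h)
  refine ⟨𝒟, hII, h𝒟I, hfrm, ?_⟩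
  -- `𝒟·𝒪_{G₀} = 𝒟'`
  have hII'' : I.comap j₀ * I.comap j₀ ≤ 𝒟' := by rw [hĪ]; exact hII'
  have h𝒟'I' : 𝒟' ≤ I.comap j₀ := by rw [hĪ]; exact h𝒟'I
  have hι₀' : ∀ p, ∃ (φp : SheafOfModules.free (Fin 1) ≅ (lineBundle (proportionalCocycle U hU w ρ hρ hprop)).over (U p))
      (u : Γ(ProjCech.PP k 1, U p)), IsUnit u ∧ ι₀.app (U p) (basisSection φp 0) = u • w p :=
    fun p => exists_frame_unit_of_lineBundleTriv (proportionalCocycle U hU w ρ hρ hprop) w ι₀ hι₀ p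
  refine comap_eq_of_chartSections_family j₀ I 𝒟 𝒟' (fun a : t => V a.1) (fun a => AA a.1 0 * xx a.1 0 + AA a.1 1 * xx a.1 1)
    hcov hII h𝒟st hII'' fun a z hz => ?_
  have h := dirLift_chartColumn_reduction j₀ I hri hfr e _ ψ hψiso hψ 𝒟' hII'' h𝒟'I' U hU w hDICT _ ι₀ hι₀' _ σ e' hσ
    (V a.1) (xx a.1) (ss a.1) (hgenV a.1) (hss a.1) (eV a.1) (heV a.1) (AA a.1) (WW a.1) (κκ a.1) (hVW a.1) (hlink a.1) z hz
  rwa [hsum] at h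

/-- The bus name of the (L) closer (skeleton / rehearsal files of res-L1-w45b-stub-4): `Tower.hLift_of_bricks = stub_elnat_three_liftSections`. -/
alias Tower.hLift_of_bricks := stub_elnat_three_liftSections

end Summit.ResolutionOfSingularities.ResolutionOfSingularities.Cruxes.EquisingularLiftNat.Sections

end
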